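import Summits.QuantumFields.YangMills.Theorems.SoloBlindReflectedFloor
import Summits.QuantumFields.YangMills.Theorems.SoloBlindSpacingPinning
import HarnessLib

/-!
# The reflected (OS-diagonal) correlator of a slab family: one-step ratio floor from a PURE floor
# (solo-QuantumFields-blind, rung D21, part 2)

`Summit.QuantumFields.YangMills.Theorems.SoloBlindReflectedEnvelope` (read-only conjunct `YangMills`).
Notation as in part 1: `Θ A := A.timeReflect`, `c_{A,B}(S; n) := latticeConnectedCorr ρ β (2S+1) A B n`,
and for a `[-T', T]`-slab species the OS-diagonal sequence along ODD lags
`d(j) := c_{ΘA,A}(S; 2j+1)`.  Part 1 showed that a pure floor `η ≤ c_{A,A}` forces the two-time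
ratio floor `ϑ = η²/(4a⁴)` (`a = sup|A|`) on `d`.  This part runs rung D19's propagation
(`mulConvex_ratio_floor`, D18) along the odd lags of a SLAB family — the parity-class bookkeeping
that the curvature species (a `[0,1]`-slab species, not time-zero spatial, not reflection
covariant) requires — with a `k`-DEPENDENT ratio `ϑ_k`:

* `sq_latticeConnectedCorr_le_reflected_mul_sup_pair` — `c_{A,B}(S; t+t'-1)² ≤ 2a² · c_{ΘB,B}(S; 2t'-1)`
  (`a = sup|A|`): a pure floor at ANY lag (even or odd, any partner `A`) feeds an odd OS-diagonal
  lag of `B`;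
* `latticeConnectedCorr_reflected_odd_logConvex` — `d(j+1)² ≤ d(j) · d(j+2)` for `T' ≤ j`,
  `j + 3 + T ≤ S` (reflection positivity, rung D8 part 8, in species language);
* `schemeTori_reflected_oneStep_ratio` — scheme level, `S = L_k`, `β_k → ∞`, slab family `A_k`,
  ratios `0 < ϑ_k ≤ 1`, odd-lag indices `T' ≤ j₁(k) < j₂(k)` at physical separation
  `2a_k (j₂(k) − j₁(k)) ≥ τ > 0`, floor `ϑ_k d_k(j₁ k) ≤ d_k(j₂ k)` eventually: then eventually in `k`,
  `e^{−2κ_k a_k} d_k(j) ≤ d_k(j+1)` for all `j₂(k) ≤ j`, `j + 2 + T ≤ L_k`, `κ_k = −log ϑ_k / τ` — per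
  lattice step (two per index step) the OS-diagonal correlator loses at most `e^{−κ_k a_k}`;
* `schemeTori_pureFloor_oneStep_ratio` — the same with the ratio of part 1 plugged in: from the pure
  floor `0 < η ≤ c_{A_k,A_k}(L_k; 2t₂(k)−1)` eventually and `|A_k| ≤ a_k` alone,
  `κ_k = −log(η²/(4a_k⁴))/τ = (4 log a_k + log 4 − 2 log η)/τ`.

For the spatially smeared curvature `a_k ≍ c_k ‖h‖₁`: the slope-pinning rate the Statement yields
for a curvature-only witness is `(4 log c_k + O(1))/τ` (paper/obstruction.md §1, referee-notes 63).
Structure only; no floor or decay is produced. [folklore: OS Schwarz / log-convexity, Seiler LNP 159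
Ch. 2; the bookkeeping is this unit's]
-/

open Filter MeasureTheory
open Literature.MathematicalPhysics.QuantumFieldTheory Literature.MathematicalPhysics.QuantumLattice

noncomputable section

namespace Summit.QuantumFields.YangMills.Theorems.SoloBlind

variable {G : Type} [Group G] [TopologicalSpace G] [IsTopologicalGroup G] [CompactSpace G]
  [MeasurableSpace G] [BorelSpace G]

/-! ### Torus level -/

section Torus

variable {N : ℕ} (ρ : G →* Matrix (Fin N) (Fin N) ℂ) (hρ : Continuous ρ) {β : ℝ} (hβ : 0 ≤ β)
  (S : ℕ)

include hρ hβ in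
/-- **A pure floor at any lag feeds an odd OS-diagonal lag**: `A` a `[-T'_A, T_A]`-slab species with
`|A| ≤ a`, `B` a `[-T'_B, T_B]`-slab species, `T_A + 1 ≤ t ≤ S − T'_A`, `T'_B + 1 ≤ t' ≤ S − T_B`:
`c_{A,B}(S; t+t'−1)² ≤ 2a² · c_{ΘB,B}(S; 2t'−1)`. [elementary from part 1] -/
theorem sq_latticeConnectedCorr_le_reflected_mul_sup_pair (A B : YMSpecies G) {T'A TA T'B TB : ℕ}
    (hA : IsSlabSupported T'A TA A) (hB : IsSlabSupported T'B TB B) {a : ℝ} (ha : ∀ U, |A.F U| ≤ a)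
    {t t' : ℕ} (ht1 : TA + 1 ≤ t) (ht2 : t + T'A ≤ S) (ht'1 : T'B + 1 ≤ t') (ht'2 : t' + TB ≤ S) :
    latticeConnectedCorr ρ β (2 * S + 1) A.F B.F (t + t' - 1) ^ 2 ≤
      2 * (a * a) * latticeConnectedCorr ρ β (2 * S + 1) B.timeReflect.F B.F (2 * t' - 1) := by
  have ha' : ∀ U, |A.timeReflect.F U| ≤ a := fun U => by simpa using ha (cfgReflect U)
  have h1 := sq_latticeConnectedCorr_le_reflected ρ hρ hβ S A B hA hB ht1 ht2 ht'1 ht'2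
  have h2 : latticeConnectedCorr ρ β (2 * S + 1) A.F A.timeReflect.F (2 * t - 1) ≤ 2 * (a * a) :=
    (le_abs_self _).trans (abs_latticeConnectedCorr_le ρ hρ β S A A.timeReflect ha ha' _)
  have h3 : 0 ≤ latticeConnectedCorr ρ β (2 * S + 1) B.timeReflect.F B.F (2 * t' - 1) := by
    have h := latticeConnectedCorr_reflected_odd_nonneg ρ hρ hβ S B hB (n := t' - 1) (by omega)
      (by omega)
    rwa [show 2 * (t' - 1) + 1 = 2 * t' - 1 by omega] at h
  exact h1.trans (mul_le_mul_of_nonneg_right h2 h3)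

include hρ hβ in
/-- **Log-convexity of the OS-diagonal correlator along odd lags**, in species language: for a
`[-T', T]`-slab species, `T' ≤ j`, `j + 3 + T ≤ S`:
`c_{ΘA,A}(S; 2j+3)² ≤ c_{ΘA,A}(S; 2j+1) · c_{ΘA,A}(S; 2j+5)`. [folklore: rung D8 part 8] -/
theorem latticeConnectedCorr_reflected_odd_logConvex (A : YMSpecies G) {T' T : ℕ}
    (hA : IsSlabSupported T' T A) {j : ℕ} (hj1 : T' ≤ j) (hj2 : j + 3 + T ≤ S) :
    latticeConnectedCorr ρ β (2 * S + 1) A.timeReflect.F A.F (2 * j + 3) ^ 2 ≤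
      latticeConnectedCorr ρ β (2 * S + 1) A.timeReflect.F A.F (2 * j + 1) *
        latticeConnectedCorr ρ β (2 * S + 1) A.timeReflect.F A.F (2 * j + 5) := by
  obtain ⟨b0, hb0⟩ := A.bounded
  set FB : GaugeConfig 4 (2 * S + 1) G → ℝ := fun U =>
    toTorusObservable (2 * S + 1) A.F U -
      wilsonExpectation ρ β (toTorusObservable (2 * S + 1) A.F) with hFB
  have hBm : Measurable FB := (A.measurable.comp (measurable_torusLift (2 * S + 1))).sub_const _
  have hBb : ∃ C : ℝ, ∀ U, |FB U| ≤ C :=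
    ⟨b0 + |wilsonExpectation ρ β (toTorusObservable (2 * S + 1) A.F)|, fun U =>
      (abs_sub _ _).trans (by gcongr; rw [toTorusObservable_apply]; exact hb0 _)⟩
  have hBs : DependsOn FB (slabEdges T' T) :=
    dependsOn_toTorusObservable_slab (by omega) (by omega) A hA _
  have h := osPairingSeq_odd_logConvex ρ (L := 2 * S + 1) (m := S) rfl (by omega) hρ hβ hBm hBb
    hBs (n := j + 1) (by omega) (by omega)
  rw [show 2 * (j + 1) + 1 = 2 * j + 3 by omega, show 2 * (j + 1) - 1 = 2 * j + 1 by omega,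
    show 2 * (j + 1) + 3 = 2 * j + 5 by omega,
    osPairingSeq_centred_eq ρ hρ β S A (2 * j + 3), osPairingSeq_centred_eq ρ hρ β S A (2 * j + 1),
    osPairingSeq_centred_eq ρ hρ β S A (2 * j + 5)] at h
  exact h

end Torus

/-! ### Scheme level: propagation along odd lags on the scheme's own tori -/

section Scheme

variable (r : LatticeRep G) {sch : SpeciesScheme (YMSpecies G)}

/-- **One-step ratio floor for the OS-diagonal correlator of a slab family** (`S = L_k`,
`d_k(j) := c_{ΘA_k,A_k}(L_k; 2j+1)`).  `A_k` `[-T', T]`-slab species, `β_k → ∞`, `0 < τ`, ratios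
`0 < ϑ_k ≤ 1` eventually, indices `T' ≤ j₁(k) < j₂(k)` with `τ ≤ a_k · 2(j₂(k) − j₁(k))`, and the
floor `ϑ_k d_k(j₁ k) ≤ d_k(j₂ k)` eventually.  Then eventually in `k`:
`e^{−(κ_k (2a_k))} d_k(j) ≤ d_k(j+1)` for `j₂(k) ≤ j`, `j + 2 + T ≤ L_k`, `κ_k = −log ϑ_k/τ`.
[this unit's; D18 `mulConvex_ratio_floor` along odd lags] -/
theorem schemeTori_reflected_oneStep_ratio (hw : sch.HasWeakCouplingLimit) (A : ℕ → YMSpecies G)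
    {T' T : ℕ} (hA : ∀ k, IsSlabSupported T' T (A k)) {τ : ℝ} (hτ : 0 < τ) (ϑ : ℕ → ℝ)
    (hϑ : ∀ᶠ k in atTop, 0 < ϑ k ∧ ϑ k ≤ 1) (j₁ j₂ : ℕ → ℕ) (hj₁ : ∀ k, T' ≤ j₁ k)
    (h12 : ∀ k, j₁ k < j₂ k) (hsep : ∀ k, τ ≤ sch.a k * (2 * ((j₂ k - j₁ k : ℕ) : ℝ)))
    (hfl : ∀ᶠ k in atTop,
      ϑ k * latticeConnectedCorr r.ρ (sch.β k) (2 * sch.L k + 1) (A k).timeReflect.F (A k).F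
          (2 * j₁ k + 1) ≤
        latticeConnectedCorr r.ρ (sch.β k) (2 * sch.L k + 1) (A k).timeReflect.F (A k).F
          (2 * j₂ k + 1)) :
    ∀ᶠ k in atTop, ∀ j : ℕ, j₂ k ≤ j → j + 2 + T ≤ sch.L k →
      Real.exp (-(-Real.log (ϑ k) / τ * (2 * sch.a k))) *
          latticeConnectedCorr r.ρ (sch.β k) (2 * sch.L k + 1) (A k).timeReflect.F (A k).F
            (2 * j + 1) ≤
        latticeConnectedCorr r.ρ (sch.β k) (2 * sch.L k + 1) (A k).timeReflect.F (A k).F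
          (2 * (j + 1) + 1) := by
  have hρ := r.continuous
  filter_upwards [hfl, hϑ, eventually_beta_nonneg hw] with k hratio hϑk hβ
  intro j hj hjL
  have hT'j₂ : T' + 1 ≤ j₂ k := by have := hj₁ k; have := h12 k; omega
  set κ : ℝ := -Real.log (ϑ k) / τ with hκ
  -- per-index-step floor `θ = e^{-κ (2 a_k)}`; `θ^{j₂-j₁} ≤ ϑ_k`
  set θ : ℝ := Real.exp (-(κ * (2 * sch.a k))) with hθ
  have hθpos : 0 < θ := Real.exp_pos _
  have hθpow : ∀ i : ℕ, θ ^ i = Real.exp (-(κ * (sch.a k * (2 * (i : ℝ))))) := fun i => by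
    rw [hθ, ← Real.exp_nat_mul]; ring_nf
  have hκ0 : 0 ≤ κ :=
    div_nonneg (neg_nonneg.mpr (Real.log_nonpos hϑk.1.le hϑk.2)) hτ.le
  have hθd : θ ^ (j₂ k - j₁ k) ≤ ϑ k := by
    rw [hθpow]
    calc Real.exp (-(κ * (sch.a k * (2 * ((j₂ k - j₁ k : ℕ) : ℝ)))))
          ≤ Real.exp (-(κ * τ)) := Real.exp_le_exp.mpr (by nlinarith [hsep k])
      _ = ϑ k := by
          rw [hκ, div_mul_cancel₀ _ hτ.ne', neg_neg, Real.exp_log hϑk.1]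
  -- the shifted odd-lag sequence `b i = d_k(T' + i)` on `[0, K]`, `K = L_k - 1 - T - T'`
  set b : ℕ → ℝ := fun i =>
    latticeConnectedCorr r.ρ (sch.β k) (2 * sch.L k + 1) (A k).timeReflect.F (A k).F
      (2 * (T' + i) + 1) with hb
  set K : ℕ := sch.L k - 1 - T - T' with hK
  have hb0 : ∀ i, i ≤ K → 0 ≤ b i := fun i hi =>
    latticeConnectedCorr_reflected_odd_nonneg r.ρ hρ hβ (sch.L k) (A k) (hA k) (n := T' + i)
      (by omega) (by omega)
  have hbconv : ∀ i, i + 2 ≤ K → b (i + 1) ^ 2 ≤ b i * b (i + 2) := by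
    intro i hi
    have h := latticeConnectedCorr_reflected_odd_logConvex r.ρ hρ hβ (sch.L k) (A k) (hA k)
      (j := T' + i) (by omega) (by omega)
    simp only [hb]
    rw [show 2 * (T' + (i + 1)) + 1 = 2 * (T' + i) + 3 by ring,
      show 2 * (T' + (i + 2)) + 1 = 2 * (T' + i) + 5 by ring]
    exact h
  have hn12 : j₁ k - T' < j₂ k - T' := by have := h12 k; have := hj₁ k; omega
  have hfloor : θ ^ ((j₂ k - T') - (j₁ k - T')) * b (j₁ k - T') ≤ b (j₂ k - T') := by
    have e1 : (j₂ k - T') - (j₁ k - T') = j₂ k - j₁ k := by have := hj₁ k; omega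
    have e2 : T' + (j₁ k - T') = j₁ k := by have := hj₁ k; omega
    have e3 : T' + (j₂ k - T') = j₂ k := by have := hj₁ k; have := h12 k; omega
    simp only [hb]
    rw [e1, e2, e3]
    have h0 : 0 ≤ latticeConnectedCorr r.ρ (sch.β k) (2 * sch.L k + 1) (A k).timeReflect.F
        (A k).F (2 * j₁ k + 1) :=
      latticeConnectedCorr_reflected_odd_nonneg r.ρ hρ hβ (sch.L k) (A k) (hA k) (n := j₁ k)
        (hj₁ k) (by have := h12 k; omega)
    exact (mul_le_mul_of_nonneg_right hθd h0).trans hratio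
  have hstep := mulConvex_ratio_floor hb0 hbconv hθpos hn12 hfloor (j - T') (by omega)
    (by have := hj₁ k; have := h12 k; omega)
  have e4 : T' + (j - T') = j := by have := hj₁ k; have := h12 k; omega
  have e5 : T' + (j - T' + 1) = j + 1 := by have := hj₁ k; have := h12 k; omega
  simp only [hb] at hstep
  rw [e4, e5] at hstep
  exact hstep

/-- **The Statement-level slope pinning for a non-reflection-covariant slab family.**  `A_k`
`[-T', T]`-slab species with `|A_k| ≤ a_k`, `β_k → ∞`, `0 < τ`, slices `T' + 1 ≤ t₁(k) < t₂(k)`,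
`t₂(k)` admissible eventually (`max T T' + 1 ≤ t₂(k) ≤ L_k − max T T'`), `τ ≤ a_k · 2(t₂(k) − t₁(k))`,
and the PURE floor `η ≤ c_{A_k,A_k}(L_k; 2t₂(k)−1)` eventually with `η > 0`.  Then, with
`ϑ_k := η²/(4a_k⁴)` and `κ_k := −log ϑ_k/τ`, eventually in `k`:
`e^{−κ_k (2a_k)} d_k(j) ≤ d_k(j+1)` for all `t₂(k) − 1 ≤ j`, `j + 2 + T ≤ L_k`
(`d_k(j) = c_{ΘA_k,A_k}(L_k; 2j+1)`): the OS-diagonal correlator loses at most `e^{−κ_k a_k}` per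
lattice step beyond the physical lag, `κ_k = (4 log a_k + log 4 − 2 log η)/τ`. [this unit's] -/
theorem schemeTori_pureFloor_oneStep_ratio (hw : sch.HasWeakCouplingLimit) (A : ℕ → YMSpecies G)
    {T' T : ℕ} (hA : ∀ k, IsSlabSupported T' T (A k)) (a : ℕ → ℝ)
    (ha : ∀ k U, |(A k).F U| ≤ a k) {τ : ℝ} (hτ : 0 < τ) (t₁ t₂ : ℕ → ℕ)
    (ht₁ : ∀ k, T' + 1 ≤ t₁ k) (h12 : ∀ k, t₁ k < t₂ k)
    (hsep : ∀ k, τ ≤ sch.a k * (2 * ((t₂ k - t₁ k : ℕ) : ℝ)))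
    (ht₂ : ∀ᶠ k in atTop, max T T' + 1 ≤ t₂ k) (ht₂' : ∀ᶠ k in atTop, t₂ k + max T T' ≤ sch.L k)
    {η : ℝ} (hη : 0 < η)
    (hfloor : ∀ᶠ k in atTop,
      η ≤ latticeConnectedCorr r.ρ (sch.β k) (2 * sch.L k + 1) (A k).F (A k).F (2 * t₂ k - 1)) :
    ∀ᶠ k in atTop, ∀ j : ℕ, t₂ k - 1 ≤ j → j + 2 + T ≤ sch.L k →
      Real.exp (-(-Real.log (η ^ 2 / (4 * (a k) ^ 4)) / τ * (2 * sch.a k))) *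
          latticeConnectedCorr r.ρ (sch.β k) (2 * sch.L k + 1) (A k).timeReflect.F (A k).F
            (2 * j + 1) ≤
        latticeConnectedCorr r.ρ (sch.β k) (2 * sch.L k + 1) (A k).timeReflect.F (A k).F
          (2 * (j + 1) + 1) := by
  have hρ := r.continuous
  -- the ratio floor of part 1, rewritten on the odd-lag indices `j = t - 1`
  have hrat := schemeTori_reflected_ratio r hw A hA a ha t₁ t₂ ht₂ ht₂' hη.le hfloor
  -- `0 < ϑ_k ≤ 1` eventually: `η ≤ c_{A,A} ≤ 2 a_k²`
  have hϑ : ∀ᶠ k in atTop, 0 < η ^ 2 / (4 * (a k) ^ 4) ∧ η ^ 2 / (4 * (a k) ^ 4) ≤ 1 := by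
    filter_upwards [hfloor] with k hk
    have hup : latticeConnectedCorr r.ρ (sch.β k) (2 * sch.L k + 1) (A k).F (A k).F
        (2 * t₂ k - 1) ≤ 2 * (a k * a k) :=
      (le_abs_self _).trans (abs_latticeConnectedCorr_le r.ρ hρ (sch.β k) (sch.L k) (A k) (A k)
        (ha k) (ha k) _)
    have h2 : η ≤ 2 * (a k * a k) := hk.trans hup
    have ha2 : 0 < a k * a k := by nlinarith
    have h4 : 0 < 4 * (a k) ^ 4 := by
      rw [show (a k) ^ 4 = (a k * a k) * (a k * a k) by ring]
      exact mul_pos (by norm_num) (mul_pos ha2 ha2)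
    refine ⟨div_pos (pow_pos hη 2) h4, ?_⟩
    rw [div_le_one h4]
    nlinarith [h2, hη.le]
  have hfl : ∀ᶠ k in atTop,
      η ^ 2 / (4 * (a k) ^ 4) * latticeConnectedCorr r.ρ (sch.β k) (2 * sch.L k + 1)
          (A k).timeReflect.F (A k).F (2 * (t₁ k - 1) + 1) ≤
        latticeConnectedCorr r.ρ (sch.β k) (2 * sch.L k + 1) (A k).timeReflect.F (A k).F
          (2 * (t₂ k - 1) + 1) := by
    filter_upwards [hrat, hϑ, hfloor] with k hk hϑk hflk
    have e1 : 2 * (t₁ k - 1) + 1 = 2 * t₁ k - 1 := by have := ht₁ k; omega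
    have e2 : 2 * (t₂ k - 1) + 1 = 2 * t₂ k - 1 := by have := ht₁ k; have := h12 k; omega
    rw [e1, e2]
    have hup : latticeConnectedCorr r.ρ (sch.β k) (2 * sch.L k + 1) (A k).F (A k).F
        (2 * t₂ k - 1) ≤ 2 * (a k * a k) :=
      (le_abs_self _).trans (abs_latticeConnectedCorr_le r.ρ hρ (sch.β k) (sch.L k) (A k) (A k)
        (ha k) (ha k) _)
    have ha2 : 0 < a k * a k := by nlinarith [hflk.trans hup]
    have h4 : 0 < 4 * (a k) ^ 4 := by
      rw [show (a k) ^ 4 = (a k * a k) * (a k * a k) by ring]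
      exact mul_pos (by norm_num) (mul_pos ha2 ha2)
    rw [div_mul_eq_mul_div, div_le_iff₀ h4]
    calc η ^ 2 * latticeConnectedCorr r.ρ (sch.β k) (2 * sch.L k + 1) (A k).timeReflect.F (A k).F
            (2 * t₁ k - 1)
        ≤ 4 * (a k) ^ 4 * latticeConnectedCorr r.ρ (sch.β k) (2 * sch.L k + 1)
            (A k).timeReflect.F (A k).F (2 * t₂ k - 1) := hk
      _ = latticeConnectedCorr r.ρ (sch.β k) (2 * sch.L k + 1) (A k).timeReflect.F (A k).F
            (2 * t₂ k - 1) * (4 * (a k) ^ 4) := by ring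
  have hmain := schemeTori_reflected_oneStep_ratio r hw A hA hτ (fun k => η ^ 2 / (4 * (a k) ^ 4))
    hϑ (fun k => t₁ k - 1) (fun k => t₂ k - 1) (fun k => by have := ht₁ k; omega)
    (fun k => by have := ht₁ k; have := h12 k; omega)
    (fun k => by
      have e : (t₂ k - 1) - (t₁ k - 1) = t₂ k - t₁ k := by have := ht₁ k; have := h12 k; omega
      rw [e]; exact hsep k)
    hfl
  filter_upwards [hmain] with k hk
  intro j hj hjL
  exact hk j hj hjL

end Scheme

end Summit.QuantumFields.YangMills.Theorems.SoloBlind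

end
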